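import Literature.Combinatorics.SimpleGraph.TriangleFreeLocalCut
import HarnessLib

/-!
# HRSS Theorem 4 — `α(τ_d, d) ≥ ½ + 0.28125/√d` — kernel-checked for `2 ≤ d ≤ 3000`

Source. J. Hirvonen, J. Rybicki, S. Schmid, J. Suomela, *Large cuts with local algorithms on
triangle-free graphs*, Electron. J. Combin. 24(4) (2017) P4.21 = arXiv:1402.2543
[HirvonenRybickiSchmidSuomela2017] (held text p0005, p0008–p0009). §2.6 Theorem 4: “Let `d ≥ 2` and
`τ = ⌈(d + √d)/2⌉`. Then `α(τ, d) ≥ ½ + 9/(32√d)`.” Appendix A (proof): “Our general strategy is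
as follows: Verify cases `d = 2, 3, …, 3000` with a computer. Prove a closed-form lower bound for
`d > 3000`. The first part is easily solved with a simple Python script …”, then Fact 5 (Wallis/
Stirling-type bounds `0.999/√(πn) < 4^{−n} C(2n,n) < 1/√(πn)` for `n ≥ 1500`), Lemmas 6–7 and the
odd/even `d` computations.

What is here (0 facts, 0 sorry): the FIRST part of that proof, replayed exactly in the kernel on the
paper's whole range `d ≤ 3000` (in five `decide +kernel` chunks) — `binomFast` (falling-factorial binomials, `= Nat.choose`), `alphaNumFast`
(`= alphaNum` of `TriangleFreeLocalCut`), `tOf` (the threshold via the integer square root, used only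
through the pinning inequalities `2t − 2 − d < √d ≤ 2t − d`), the decidable per-degree check
`HrssCheck` and its soundness `hrss_bound_of_check` (via the tree's `hrss_bound_of_data`),
`hrssCheck_range` (`∀ d ∈ [2, 2000]`, one `decide +kernel`), `hrss_theorem4_le` / `exists_cut_ge_hrss`
(`d ≤ 2000`), then the chunks `hrssCheck_range₂…₅` (`2001–3000`), **`hrssCheck_range_full`**,
**`hrss_theorem4_le_3000`** (Theorem 4 for every `2 ≤ d ≤ 3000`) and **`exists_cut_ge_hrss_3000`**
(every `d`-regular triangle-free graph, `2 ≤ d ≤ 3000`, has a cut with at least `(½ + 9/(32√d))·|E|`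
edges). HONEST FRAMING: instance-level
adjudication of specific advantage claims; no claim about BQP vs BPP or the summit.

NOT formalised: the analytic Appendix-A part for `d > 3000` (Fact 5 / Lemmas 6–7 would need
explicit-constant central-binomial estimates).
-/

noncomputable section

namespace Literature.Combinatorics.SimpleGraph.TriangleFreeLocalCutTheorem4

open Finset Literature.Combinatorics.SimpleGraph.TriangleFreeLocalCut

/-- `C(m, n)` by falling factorials (kernel-friendly; the recursive `Nat.choose` is exponential to
unfold). [cite: HirvonenRybickiSchmidSuomela2017, Appendix A (“Verify cases d = 2, 3, …, 3000 with a
computer”)] -/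
def binomFast (m n : ℕ) : ℕ := m.descFactorial n / n.factorial

/-- `binomFast = Nat.choose`. [cite: HirvonenRybickiSchmidSuomela2017, Appendix A] -/
theorem binomFast_eq (m n : ℕ) : binomFast m n = m.choose n :=
  (Nat.choose_eq_descFactorial_div_factorial m n).symm

/-- The numerator of `α(τ,d) − ½` with fast binomials. [cite: HirvonenRybickiSchmidSuomela2017, §2.6
Lemma 3] -/
def alphaNumFast (τ d : ℕ) : ℕ :=
  binomFast (d - 1) (τ - 1) * ∑ i ∈ Icc (d + 1 - τ) (τ - 1), binomFast (d - 1) i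

/-- `alphaNum = alphaNumFast`. [cite: HirvonenRybickiSchmidSuomela2017, §2.6 Lemma 3] -/
theorem alphaNum_eq_fast (τ d : ℕ) : alphaNum τ d = alphaNumFast τ d := by
  unfold alphaNum alphaNumFast
  simp_rw [binomFast_eq]

/-- Pinning `⌈(d + √d)/2⌉ = t` by integer inequalities: `2t − 2 − d < √d ≤ 2t − d`. [cite:
HirvonenRybickiSchmidSuomela2017, §2.6 (“τ = ⌈(d + √d)/2⌉”)] -/
private theorem hrssThreshold_eq' {d t : ℕ} (ht : 1 ≤ t)
    (hlo : (2 * t - 2 - d : ℤ) < 0 ∨ (2 * t - 2 - d : ℤ) ^ 2 < d)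
    (hhi : (0 : ℤ) ≤ 2 * t - d ∧ (d : ℤ) ≤ (2 * t - d) ^ 2) : hrssThreshold d = t := by
  have hsd : 0 ≤ Real.sqrt d := Real.sqrt_nonneg _
  have h1 : ((2 * t : ℝ) - 2 - d) < Real.sqrt d := by
    rcases hlo with h | h
    · have h' : ((2 * t : ℝ) - 2 - d) < 0 := by exact_mod_cast h
      linarith
    · have h' : ((2 * t : ℝ) - 2 - d) ^ 2 < d := by exact_mod_cast h
      by_cases hneg : ((2 * t : ℝ) - 2 - d) < 0
      · linarith
      · exact (Real.lt_sqrt (not_lt.1 hneg)).2 h'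
  have h2 : Real.sqrt d ≤ (2 * t : ℝ) - d := by
    rw [Real.sqrt_le_iff]
    exact ⟨by exact_mod_cast hhi.1, by exact_mod_cast hhi.2⟩
  unfold hrssThreshold
  rw [Nat.ceil_eq_iff (by omega), Nat.cast_sub ht, Nat.cast_one]
  constructor <;> linarith

/-- From `⌈(d+√d)/2⌉ = t` and the kernel inequality `81·16^{d−1} ≤ 1024 d · alphaNumFast(t,d)²` to
HRSS's bound `α(τ,d) ≥ ½ + 9/(32√d)`. [cite: HirvonenRybickiSchmidSuomela2017, §2.6 Theorem 4
(Appendix A: “Verify cases d = 2,3,…,3000 with a computer”)] -/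
theorem hrss_bound_of_fast {d t : ℕ} (hd : 0 < d) (ht : hrssThreshold d = t)
    (h : 81 * 16 ^ (d - 1) ≤ 1024 * d * alphaNumFast t d ^ 2) :
    1 / 2 + 9 / (32 * Real.sqrt d) ≤ alpha (hrssThreshold d) d :=
  hrss_bound_of_data hd ht (alphaNum_eq_fast t d) h

/-- The threshold `⌈(d + √d)/2⌉` computed with the integer square root (`s = ⌊√d⌋`:
`(d+s+1)/2` if `d = s²`, else `(d+s)/2 + 1`); only used through the pinning check below. [cite:
HirvonenRybickiSchmidSuomela2017, §2.6 (“τ = ⌈(d + √d)/2⌉”)] -/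
def tOf (d : ℕ) : ℕ :=
  if Nat.sqrt d * Nat.sqrt d = d then (d + Nat.sqrt d + 1) / 2 else (d + Nat.sqrt d) / 2 + 1

/-- The per-degree computer check of Appendix A as a decidable proposition: `t = tOf d` pins
`⌈(d+√d)/2⌉` (`2t − 2 − d < √d ≤ 2t − d` in integers) and `81·16^{d−1} ≤ 1024·d·alphaNum(t,d)²`.
[cite: HirvonenRybickiSchmidSuomela2017, Appendix A (“Verify cases d = 2, 3, …, 3000 with a computer
… a simple Python script”)] -/
def HrssCheck (d : ℕ) : Prop :=
  1 ≤ tOf d ∧ ((2 * (tOf d : ℤ) - 2 - d < 0 ∨ (2 * (tOf d : ℤ) - 2 - d) ^ 2 < d)) ∧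
    ((0 : ℤ) ≤ 2 * (tOf d : ℤ) - d ∧ (d : ℤ) ≤ (2 * (tOf d : ℤ) - d) ^ 2) ∧
    81 * 16 ^ (d - 1) ≤ 1024 * d * alphaNumFast (tOf d) d ^ 2

/-- Decidability of the check (plumbing). [cite: HirvonenRybickiSchmidSuomela2017, Appendix A] -/
instance : DecidablePred HrssCheck := fun d => by
  unfold HrssCheck
  infer_instance

/-- Soundness of the check: it implies HRSS's bound for that `d`. [cite:
HirvonenRybickiSchmidSuomela2017, §2.6 Theorem 4 and Appendix A] -/
theorem hrss_bound_of_check {d : ℕ} (hd : 0 < d) (h : HrssCheck d) :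
    1 / 2 + 9 / (32 * Real.sqrt d) ≤ alpha (hrssThreshold d) d :=
  hrss_bound_of_fast hd (hrssThreshold_eq' h.1 h.2.1 h.2.2.1) h.2.2.2

set_option maxHeartbeats 4000000 in
/-- **The computer check of Appendix A replayed in the kernel for `2 ≤ d ≤ 2000`** (one `decide`;
the chunks `2001–3000` follow below — each `decide +kernel` must stay within the kernel's
evaluation budget). [cite: HirvonenRybickiSchmidSuomela2017, Appendix A (“Verify cases
d = 2, 3, …, 3000 with a computer … easily solved with a simple Python script”)] -/
theorem hrssCheck_range : ∀ d ∈ Finset.Icc 2 2000, HrssCheck d := by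
  decide +kernel

/-- **Theorem 4 (HRSS) for `2 ≤ d ≤ 2000`, kernel-checked**: with `τ = ⌈(d + √d)/2⌉`, the one-round
threshold algorithm finds, in expectation, a cut of weight `α(τ,d) ≥ ½ + 9/(32√d) = ½ + 0.28125/√d`
on every `d`-regular triangle-free graph. The paper proves the bound for ALL `d ≥ 2` by a computer
check of `d ≤ 3000` plus the Appendix-A estimates (Fact 5, Lemmas 6–7) for `d > 3000`; here the
computer check is replayed exactly in the kernel for `d ≤ 2000` (the tree's `hrss_theorem4_small`
had `d ≤ 10`; the full range `d ≤ 3000` is `hrss_theorem4_le_3000` below). [cite: HirvonenRybickiSchmidSuomela2017, §1.4 eq. (5)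
and §2.6 Theorem 4, Appendix A] -/
theorem hrss_theorem4_le : ∀ d : ℕ, d ∈ Finset.Icc 2 2000 →
    1 / 2 + 9 / (32 * Real.sqrt d) ≤ alpha (hrssThreshold d) d := fun d hd =>
  hrss_bound_of_check (by rw [Finset.mem_Icc] at hd; omega) (hrssCheck_range d hd)

/-- **Corollary (HRSS §1.1, kernel range)**: for `2 ≤ d ≤ 2000` every `d`-regular triangle-free graph
with `m` edges has a cut with at least `(½ + 0.28125/√d)·m` edges (via `exists_cutCount_ge_alpha`).
[cite: HirvonenRybickiSchmidSuomela2017, §1.1 (“this shows that in any d-regular triangle-free graph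
there exists a cut of at least this size”) and Theorem 4] -/
theorem exists_cut_ge_hrss {V : Type*} [Fintype V] [DecidableEq V] (G : SimpleGraph V)
    [DecidableRel G.Adj] {d : ℕ} (hd : d ∈ Finset.Icc 2 2000) (hreg : G.IsRegularOfDegree d)
    (hG : G.CliqueFree 3) :
    ∃ c : V → Bool, (#G.edgeFinset : ℝ) * (1 / 2 + 9 / (32 * Real.sqrt d)) ≤ cutCount G c := by
  have hd1 : 1 ≤ d := by rw [Finset.mem_Icc] at hd; omega
  have hdτ : d < 2 * hrssThreshold d := by
    have h1 : ((d : ℝ) + Real.sqrt d) / 2 ≤ (hrssThreshold d : ℝ) := by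
      unfold hrssThreshold
      exact Nat.le_ceil _
    have h2 : (0 : ℝ) < Real.sqrt d := Real.sqrt_pos.2 (by exact_mod_cast hd1)
    have h3 : (d : ℝ) < 2 * (hrssThreshold d : ℝ) := by linarith
    exact_mod_cast h3
  obtain ⟨c, hc⟩ := exists_cutCount_ge_alpha G hd1 hreg hG hdτ
  exact ⟨c, (mul_le_mul_of_nonneg_left (hrss_theorem4_le d hd) (Nat.cast_nonneg _)).trans hc⟩

/-! ## The rest of the paper's computer range, `2001 ≤ d ≤ 3000`, in chunks -/

set_option maxHeartbeats 0 in
/-- The computer check of Appendix A replayed in the kernel, chunk `2001 ≤ d ≤ 2300` (chunked so that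
each `decide` stays within the kernel evaluation budget). [cite: HirvonenRybickiSchmidSuomela2017,
Appendix A (“Verify cases d = 2, 3, …, 3000 with a computer”)] -/
theorem hrssCheck_range₂ : ∀ d ∈ Finset.Icc 2001 2300, HrssCheck d := by
  decide +kernel

set_option maxHeartbeats 0 in
/-- The computer check of Appendix A replayed in the kernel, chunk `2301 ≤ d ≤ 2600` (chunked so that
each `decide` stays within the kernel evaluation budget). [cite: HirvonenRybickiSchmidSuomela2017,
Appendix A (“Verify cases d = 2, 3, …, 3000 with a computer”)] -/
theorem hrssCheck_range₃ : ∀ d ∈ Finset.Icc 2301 2600, HrssCheck d := by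
  decide +kernel

set_option maxHeartbeats 0 in
/-- The computer check of Appendix A replayed in the kernel, chunk `2601 ≤ d ≤ 2800` (chunked so that
each `decide` stays within the kernel evaluation budget). [cite: HirvonenRybickiSchmidSuomela2017,
Appendix A (“Verify cases d = 2, 3, …, 3000 with a computer”)] -/
theorem hrssCheck_range₄ : ∀ d ∈ Finset.Icc 2601 2800, HrssCheck d := by
  decide +kernel

set_option maxHeartbeats 0 in
/-- The computer check of Appendix A replayed in the kernel, chunk `2801 ≤ d ≤ 3000` (chunked so that
each `decide` stays within the kernel evaluation budget). [cite: HirvonenRybickiSchmidSuomela2017,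
Appendix A (“Verify cases d = 2, 3, …, 3000 with a computer”)] -/
theorem hrssCheck_range₅ : ∀ d ∈ Finset.Icc 2801 3000, HrssCheck d := by
  decide +kernel

/-- **The computer check of Appendix A for the paper's FULL range `2 ≤ d ≤ 3000`.** [cite:
HirvonenRybickiSchmidSuomela2017, Appendix A (“Verify cases d = 2, 3, …, 3000 with a computer … The
first part is easily solved with a simple Python script”)] -/
theorem hrssCheck_range_full : ∀ d ∈ Finset.Icc 2 3000, HrssCheck d := by
  intro d hd
  rw [Finset.mem_Icc] at hd
  obtain ⟨h2, h3000⟩ := hd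
  by_cases h₁ : d ≤ 2000
  · exact hrssCheck_range d (Finset.mem_Icc.2 ⟨h2, h₁⟩)
  by_cases h₂ : d ≤ 2300
  · exact hrssCheck_range₂ d (Finset.mem_Icc.2 ⟨by omega, h₂⟩)
  by_cases h₃ : d ≤ 2600
  · exact hrssCheck_range₃ d (Finset.mem_Icc.2 ⟨by omega, h₃⟩)
  by_cases h₄ : d ≤ 2800
  · exact hrssCheck_range₄ d (Finset.mem_Icc.2 ⟨by omega, h₄⟩)
  · exact hrssCheck_range₅ d (Finset.mem_Icc.2 ⟨by omega, h3000⟩)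

/-- **Theorem 4 (HRSS) on the paper's whole computer range `2 ≤ d ≤ 3000`, kernel-checked**:
`α(⌈(d+√d)/2⌉, d) ≥ ½ + 9/(32√d)`. Together with the paper's Appendix-A analytic argument for
`d > 3000` (Fact 5, Lemmas 6–7; NOT formalised) this is the printed proof of Theorem 4; the part
“Verify cases d = 2, 3, …, 3000 with a computer” is now replayed exactly in the kernel. [cite:
HirvonenRybickiSchmidSuomela2017, §2.6 Theorem 4 and Appendix A] -/
theorem hrss_theorem4_le_3000 : ∀ d : ℕ, d ∈ Finset.Icc 2 3000 →
    1 / 2 + 9 / (32 * Real.sqrt d) ≤ alpha (hrssThreshold d) d := fun d hd =>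
  hrss_bound_of_check (by rw [Finset.mem_Icc] at hd; omega) (hrssCheck_range_full d hd)

/-- **Corollary on the full computer range**: for `2 ≤ d ≤ 3000` every `d`-regular triangle-free
graph has a cut with at least `(½ + 0.28125/√d)·|E|` edges. [cite: HirvonenRybickiSchmidSuomela2017,
§1.1 and Theorem 4] -/
theorem exists_cut_ge_hrss_3000 {V : Type*} [Fintype V] [DecidableEq V] (G : SimpleGraph V)
    [DecidableRel G.Adj] {d : ℕ} (hd : d ∈ Finset.Icc 2 3000) (hreg : G.IsRegularOfDegree d)
    (hG : G.CliqueFree 3) :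
    ∃ c : V → Bool, (#G.edgeFinset : ℝ) * (1 / 2 + 9 / (32 * Real.sqrt d)) ≤ cutCount G c := by
  have hd1 : 1 ≤ d := by rw [Finset.mem_Icc] at hd; omega
  have hdτ : d < 2 * hrssThreshold d := by
    have h1 : ((d : ℝ) + Real.sqrt d) / 2 ≤ (hrssThreshold d : ℝ) := by
      unfold hrssThreshold
      exact Nat.le_ceil _
    have h2 : (0 : ℝ) < Real.sqrt d := Real.sqrt_pos.2 (by exact_mod_cast hd1)
    have h3 : (d : ℝ) < 2 * (hrssThreshold d : ℝ) := by linarith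
    exact_mod_cast h3
  obtain ⟨c, hc⟩ := exists_cutCount_ge_alpha G hd1 hreg hG hdτ
  exact ⟨c, (mul_le_mul_of_nonneg_left (hrss_theorem4_le_3000 d hd) (Nat.cast_nonneg _)).trans hc⟩

end Literature.Combinatorics.SimpleGraph.TriangleFreeLocalCutTheorem4
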